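import Literature.MathematicalPhysics.QuantumFieldTheory.ConformalBootstrap3D.PointKernelK34v2Data
import Literature.MathematicalPhysics.QuantumFieldTheory.ConformalBootstrap3D.PointKernelParts

/-!
# K34v2 certificate, kernel part file P6: one-cell head segments 99 in level ranges

The head cells whose kernel evaluation exceeds one `decide` are one-cell segments of `hsegsK34v2`; each is
checked by `PCert.hPartSideOK` (side conditions) and `PCert.hPartOK` per level range `[n_lo, n_lo + count)`
against an integer claim, the claims summing to `≥ 0` (`PointKernel.partsOK`); soundness is
`PCert.hParts_sound` (`PointKernelParts`).  The part files `P1, P2, …` are mutually independent (each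
imports only the data file); the ranges of one cell may span several of them, and the per-cell
conclusions `hparts_i` / `hcell_i` of those cells are assembled in `PointKernelK34v2.lean`.
Estimated kernel time 257 s.
-/

set_option maxRecDepth 100000
set_option maxHeartbeats 0

namespace Literature.MathematicalPhysics.QuantumFieldTheory.ConformalBootstrap3D.PointKernelK34v2

open Literature.MathematicalPhysics.QuantumFieldTheory.ConformalBootstrap3D.PointKernel

/-- one-cell segment 99 (row 4, cell `[5121/1024, 2561/512]`, chord, `n_F = 66`,
7 level ranges): side conditions. [folklore] -/
theorem pside_99 : certK34v2.hPartSideOK (PCert.segAt hsegsK34v2 99) JHK34v2 = true := by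
  decide +kernel

/-- its level ranges `(n_lo, count, claim)`. [folklore] -/
def parts_99 : List (ℕ × ℕ × ℤ) := [(0, 29, -3633209117683770936515928009454207295), (29, 12, 2670157275275541931293106582264135136), (41, 8, 624317793100636650220261792349145535), (49, 7, 226425301205538314846535065220481132), (56, 5, 74766867580692658294320988608701384), (61, 5, 38493482678774461887044978279805928), (66, 1, -951602157413080025341397268061819)]

/-- the ranges tile `[0, n_F]` and the claims sum to `≥ 0`. [folklore] -/
theorem pcov_99 : PointKernel.partsOK 66 parts_99 = true := by
  decide +kernel

/-- levels `[0, 29)` of segment 99: partial lower sum `≥` claim. [folklore] -/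
theorem part_99_0 : certK34v2.hPartOK (PCert.segAt hsegsK34v2 99) JHK34v2 0 29 (-3633209117683770936515928009454207295) = true := by
  decide +kernel

/-- levels `[29, 41)` of segment 99: partial lower sum `≥` claim. [folklore] -/
theorem part_99_1 : certK34v2.hPartOK (PCert.segAt hsegsK34v2 99) JHK34v2 29 12 (2670157275275541931293106582264135136) = true := by
  decide +kernel

/-- levels `[41, 49)` of segment 99: partial lower sum `≥` claim. [folklore] -/
theorem part_99_2 : certK34v2.hPartOK (PCert.segAt hsegsK34v2 99) JHK34v2 41 8 (624317793100636650220261792349145535) = true := by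
  decide +kernel

/-- levels `[49, 56)` of segment 99: partial lower sum `≥` claim. [folklore] -/
theorem part_99_3 : certK34v2.hPartOK (PCert.segAt hsegsK34v2 99) JHK34v2 49 7 (226425301205538314846535065220481132) = true := by
  decide +kernel

end Literature.MathematicalPhysics.QuantumFieldTheory.ConformalBootstrap3D.PointKernelK34v2
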